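import Literature.Barriers.CriticalPhenomena.WeaklySAWFiniteVolumeDerivatives
import Literature.Barriers.CriticalPhenomena.WeaklySAWSubmultiplicativity
import HarnessLib

/-!
# BBS 2015, §4.1 in finite volume: `χ̂_N`, `χ_N = (1+z₀)χ̂_N`, `χ̂ = lim χ̂_N` and
# `∂χ̂/∂ν₀ = lim ∂χ̂_N/∂ν₀` — the entry point of §8.4

Companion to `WeaklySAWFiniteVolume.lean` / `WeaklySAWFiniteVolumeDerivatives.lean` (§2 of
Bauerschmidt–Brydges–Slade, CMP 337 (2015), arXiv:1403.7422: `torusSusceptibility = χ_N`, Lemma 2.1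
with all derivatives) and to `WeaklySAWFourDimLogCorrectionsReduction.lean` (`chiHat`: the
renormalised susceptibility `χ̂(m²,g₀,ν₀,z₀)` of §4.1, defined through `χ(g,ν) = (1+z₀)χ̂` at
`g = g₀/(1+z₀)²`, `ν = (ν₀+m²)/(1+z₀)`; the named fact `BBS2015_thm41` = Theorem 4.1 is stated in
terms of `chiHat` and `∂chiHat/∂ν₀`).

§4.1 of the source works in FINITE volume: `χ̂_N(m²,g₀,ν₀,z₀) = Σ_x E_C(e^{-V₀(Λ)}φ̄₀φ_x)` with
`χ_N(g,ν) = (1+z₀)χ̂_N`, `χ̂ = lim_N χ̂_N` ("exists by Lemma 2.1" and the previous identity),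
`χ = (1+z₀)χ̂` and, for `ν > ν_c`, `∂χ/∂ν = (1+z₀)²∂χ̂/∂ν₀ = (1+z₀)² lim_N ∂χ̂_N/∂ν₀`
("Lemma 2.1 and the chain rule") — the four displays following the definition of `χ̂_N`;
Theorem 4.1 is then proved in §8.4 by computing `χ̂_N` and `∂χ̂_N/∂ν₀` from the
renormalisation-group flow (the identity for `χ̂_N` opening §8.4) and letting `N → ∞`. This file
supplies that finite-volume layer on the walk side (everything proved; the one definition is
`chiHatN`, the finite-volume twin of `chiHat`):

* `chiHatN d n m2 g₀ ν₀ z₀ := χ_N(g₀/(1+z₀)², (ν₀+m²)/(1+z₀)).toReal/(1+z₀)`; `one_add_mul_chiHatN`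
  (`χ_N = (1+z₀)χ̂_N`), `one_add_mul_chiHat` (`χ = (1+z₀)χ̂`), `chiHatN_zero_right`;
* `χ̂ = lim_N χ̂_N`: `tendsto_chiHatN`, `tendsto_chiHatN_pow` (above `ν_c`, any periods / `Lᴺ`);
* `∂χ/∂ν = (1+z₀)²∂χ̂/∂ν₀ = (1+z₀)² lim_N ∂χ̂_N/∂ν₀`: `hasDerivAt_chiHat`, `hasDerivAt_chiHatN`
  (`∂χ̂/∂ν₀ = (1+z₀)⁻²∂χ/∂ν`, chain rule),
  `deriv_susceptibility_eq_mul_deriv_chiHat` (`∂χ/∂ν = (1+z₀)²∂χ̂/∂ν₀`), `tendsto_deriv_chiHatN`,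
  `tendsto_deriv_chiHatN_pow` (`∂χ̂_N/∂ν₀ → ∂χ̂/∂ν₀` above `ν_c`);
* the two "read-off" lemmas through which §8.4 concludes Theorem 4.1 from finite volume:
  **`criticalNu_lt_and_chiHat_eq_of_tendsto`** — if `χ̂_N(m²,g₀,ν₀,z₀) → A ∈ ℝ` along `Λ_N`
  (`g₀ > 0`, `z₀ > -1`, `d ≥ 1`) then the bare `ν` is above `ν_c(g)` (Lemma 2.1 in `[0,∞]` and
  `χ < ∞ ↔ ν > ν_c` of Lemma A.1, `susceptibility_lt_top_iff`) and `χ̂ = A`; and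
  **`deriv_chiHat_eq_of_tendsto`** — above `ν_c`, `∂χ̂_N/∂ν₀ → D` implies `∂χ̂/∂ν₀ = D`.

What these do NOT contain is the renormalisation-group input itself (the identity
`χ̂_N = m⁻² + m⁻⁴(-ν_N + |Λ|⁻¹D²W_N⁰ + |Λ|⁻¹D²K_N⁰)` of §8.3–8.4 with the estimates of §7–§8,
which rest on the supersymmetric representation and the companion papers).

Locators: §4.1 and §8.4 by section, their displays by content (display numbers are not legible
in the held text).
-/

noncomputable section

open MeasureTheory Filter Topology Set
open Literature.Probability.LatticeModels
open scoped ENNReal BigOperators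

namespace Literature.Barriers.CriticalPhenomena

namespace CTWSAW

variable {d : ℕ}

/-! ### `χ̂_N` and the identity `χ_N(g,ν) = (1+z₀) χ̂_N(m²,g₀,ν₀,z₀)` -/

/-- The finite-volume renormalised susceptibility `χ̂_N(m², g₀, ν₀, z₀)` of §4.1, defined — as
`chiHat` is from `χ` — through the identity `χ_N(g,ν) = (1+z₀)χ̂_N(m²,g₀,ν₀,z₀)` at the bare
parameters `g = g₀/(1+z₀)²`, `ν = (ν₀+m²)/(1+z₀)` (torus of period `n = Lᴺ`; real-valued via
`toReal`, so `0` where `χ_N = ∞`). In the source `χ̂_N = Σ_{x∈Λ} E_C(e^{-V₀(Λ)}φ̄₀φ_x)` and the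
identity is derived from Proposition 3.1 by the rescaling `φ ↦ (1+z₀)^{1/2}φ`.
[cite: BauerschmidtBrydgesSlade2015LogCorr, §4.1 (definition of χ̂_N and the display χ_N(g,ν) = (1+z₀)χ̂_N(m²,g₀,ν₀,z₀))] -/
def chiHatN (d n : ℕ) (m2 g₀ ν₀ z₀ : ℝ) : ℝ :=
  (torusSusceptibility d n (g₀ / (1 + z₀) ^ 2) ((ν₀ + m2) / (1 + z₀))).toReal / (1 + z₀)

/-- **`χ_N(g,ν) = (1+z₀)χ̂_N(m²,g₀,ν₀,z₀)`** (`z₀ > -1`; both sides real, `0` if `χ_N = ∞`).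
[cite: BauerschmidtBrydgesSlade2015LogCorr, §4.1 (display χ_N(g,ν) = (1+z₀)χ̂_N)] -/
theorem one_add_mul_chiHatN (d n : ℕ) (m2 g₀ ν₀ : ℝ) {z₀ : ℝ} (hz : -1 < z₀) :
    (1 + z₀) * chiHatN d n m2 g₀ ν₀ z₀ =
      (torusSusceptibility d n (g₀ / (1 + z₀) ^ 2) ((ν₀ + m2) / (1 + z₀))).toReal := by
  have h1 : (1 + z₀) ≠ 0 := by linarith
  unfold chiHatN
  field_simp

/-- `χ(g,ν) = (1+z₀)χ̂(m²,g₀,ν₀,z₀)` (`z₀ > -1`), the infinite-volume form, for `chiHat`.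
[cite: BauerschmidtBrydgesSlade2015LogCorr, §4.1 (display χ(g,ν) = (1+z₀)χ̂(m²,g₀,ν₀,z₀))] -/
theorem one_add_mul_chiHat (d : ℕ) (m2 g₀ ν₀ : ℝ) {z₀ : ℝ} (hz : -1 < z₀) :
    (1 + z₀) * chiHat d m2 g₀ ν₀ z₀ =
      (susceptibility d (g₀ / (1 + z₀) ^ 2) ((ν₀ + m2) / (1 + z₀))).toReal := by
  have h1 : (1 + z₀) ≠ 0 := by linarith
  unfold chiHat
  field_simp

/-- With `z₀ = 0`: `χ̂_N(m², g₀, ν₀, 0) = χ_N(g₀, ν₀ + m²)`. [cite: BauerschmidtBrydgesSlade2015LogCorr, §4.1 (renormalised parameters at z₀ = 0)] -/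
theorem chiHatN_zero_right (d n : ℕ) (m2 g₀ ν₀ : ℝ) :
    chiHatN d n m2 g₀ ν₀ 0 = (torusSusceptibility d n g₀ (ν₀ + m2)).toReal := by
  simp [chiHatN]

/-- The bare coupling `g = g₀/(1+z₀)²` is non-negative with `g₀`. [folklore] -/
theorem bare_g_nonneg {g₀ : ℝ} (hg₀ : 0 ≤ g₀) (z₀ : ℝ) : 0 ≤ g₀ / (1 + z₀) ^ 2 :=
  div_nonneg hg₀ (sq_nonneg _)

/-! ### `χ̂ = lim_N χ̂_N` above `ν_c` -/

/-- **`χ̂(m²,g₀,ν₀,z₀) = lim_{N→∞} χ̂_N(m²,g₀,ν₀,z₀)`** along any periods `n → ∞`, for `g₀ ≥ 0`,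
`z₀ > -1` and bare `ν = (ν₀+m²)/(1+z₀) > ν_c(g)` ("The limit … exists by Lemma 2.1 and" the identity `χ_N = (1+z₀)χ̂_N`).
[cite: BauerschmidtBrydgesSlade2015LogCorr, §4.1 (display χ̂ = lim_{N→∞} χ̂_N)] -/
theorem tendsto_chiHatN {g₀ : ℝ} (hg₀ : 0 ≤ g₀) (m2 ν₀ z₀ : ℝ)
    (hν : criticalNu d (g₀ / (1 + z₀) ^ 2) < (ν₀ + m2) / (1 + z₀)) :
    Tendsto (fun n => chiHatN d n m2 g₀ ν₀ z₀) atTop (𝓝 (chiHat d m2 g₀ ν₀ z₀)) := by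
  unfold chiHatN chiHat
  exact (tendsto_torusSusceptibility_toReal (bare_g_nonneg hg₀ z₀) hν).div_const _

/-- The same along `Λ_N = ℤ^d/Lᴺℤ^d`, `L ≥ 2`. [cite: BauerschmidtBrydgesSlade2015LogCorr, §4.1 (display χ̂ = lim_{N→∞} χ̂_N)] -/
theorem tendsto_chiHatN_pow {L : ℕ} (hL : 2 ≤ L) {g₀ : ℝ} (hg₀ : 0 ≤ g₀) (m2 ν₀ z₀ : ℝ)
    (hν : criticalNu d (g₀ / (1 + z₀) ^ 2) < (ν₀ + m2) / (1 + z₀)) :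
    Tendsto (fun N : ℕ => chiHatN d (L ^ N) m2 g₀ ν₀ z₀) atTop (𝓝 (chiHat d m2 g₀ ν₀ z₀)) :=
  (tendsto_chiHatN hg₀ m2 ν₀ z₀ hν).comp (tendsto_pow_atTop_atTop_of_one_lt hL)

/-! ### `∂χ/∂ν = (1+z₀)² ∂χ̂/∂ν₀ = (1+z₀)² lim_N ∂χ̂_N/∂ν₀` above `ν_c` -/

/-- **`∂χ̂/∂ν₀`**: for `g₀ ≥ 0`, `z₀ > -1`, `ν = (ν₀+m²)/(1+z₀) > ν_c(g)`, the map
`ν₀' ↦ χ̂(m²,g₀,ν₀',z₀)` has derivative `(1+z₀)⁻² ∂χ/∂ν(g,ν)` at `ν₀` ("by Lemma 2.1 and the chain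
rule"). [cite: BauerschmidtBrydgesSlade2015LogCorr, §4.1 (display ∂χ/∂ν = (1+z₀)²∂χ̂/∂ν₀)] -/
theorem hasDerivAt_chiHat {g₀ : ℝ} (hg₀ : 0 ≤ g₀) (m2 ν₀ : ℝ) {z₀ : ℝ} (hz : -1 < z₀)
    (hν : criticalNu d (g₀ / (1 + z₀) ^ 2) < (ν₀ + m2) / (1 + z₀)) :
    HasDerivAt (fun ν₀' => chiHat d m2 g₀ ν₀' z₀)
      (deriv (fun ν' => (susceptibility d (g₀ / (1 + z₀) ^ 2) ν').toReal) ((ν₀ + m2) / (1 + z₀))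
        / (1 + z₀) ^ 2) ν₀ := by
  have h1 : (1 + z₀) ≠ 0 := by linarith
  have hχ := hasDerivAt_susceptibility_toReal (d := d) (bare_g_nonneg hg₀ z₀) hν
  have haff : HasDerivAt (fun ν₀' : ℝ => (ν₀' + m2) / (1 + z₀)) (1 / (1 + z₀)) ν₀ := by
    have := ((hasDerivAt_id ν₀).add_const m2).div_const (1 + z₀)
    simpa using this
  have hcomp : HasDerivAt
      (fun ν₀' => (susceptibility d (g₀ / (1 + z₀) ^ 2) ((ν₀' + m2) / (1 + z₀))).toReal / (1 + z₀))
      (deriv (fun ν' => (susceptibility d (g₀ / (1 + z₀) ^ 2) ν').toReal) ((ν₀ + m2) / (1 + z₀))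
        * (1 / (1 + z₀)) / (1 + z₀)) ν₀ :=
    (hχ.differentiableAt.hasDerivAt.comp ν₀ haff).div_const (1 + z₀)
  unfold chiHat
  refine hcomp.congr_deriv ?_
  field_simp

/-- **`∂χ̂_N/∂ν₀`**, the finite-volume analogue: derivative `(1+z₀)⁻² ∂χ_N/∂ν(g,ν)` at `ν₀`
(`g₀ ≥ 0`, `z₀ > -1`, `ν > ν_c(g)`). [cite: BauerschmidtBrydgesSlade2015LogCorr, §4.1 (display ∂χ/∂ν = (1+z₀)² lim_N ∂χ̂_N/∂ν₀)] -/
theorem hasDerivAt_chiHatN (n : ℕ) {g₀ : ℝ} (hg₀ : 0 ≤ g₀) (m2 ν₀ : ℝ) {z₀ : ℝ} (hz : -1 < z₀)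
    (hν : criticalNu d (g₀ / (1 + z₀) ^ 2) < (ν₀ + m2) / (1 + z₀)) :
    HasDerivAt (fun ν₀' => chiHatN d n m2 g₀ ν₀' z₀)
      (deriv (fun ν' => (torusSusceptibility d n (g₀ / (1 + z₀) ^ 2) ν').toReal)
          ((ν₀ + m2) / (1 + z₀)) / (1 + z₀) ^ 2) ν₀ := by
  have h1 : (1 + z₀) ≠ 0 := by linarith
  have hχ := hasDerivAt_torusSusceptibility_toReal (d := d) n (bare_g_nonneg hg₀ z₀) hν
  have haff : HasDerivAt (fun ν₀' : ℝ => (ν₀' + m2) / (1 + z₀)) (1 / (1 + z₀)) ν₀ := by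
    have := ((hasDerivAt_id ν₀).add_const m2).div_const (1 + z₀)
    simpa using this
  have hcomp : HasDerivAt
      (fun ν₀' => (torusSusceptibility d n (g₀ / (1 + z₀) ^ 2)
        ((ν₀' + m2) / (1 + z₀))).toReal / (1 + z₀))
      (deriv (fun ν' => (torusSusceptibility d n (g₀ / (1 + z₀) ^ 2) ν').toReal)
        ((ν₀ + m2) / (1 + z₀)) * (1 / (1 + z₀)) / (1 + z₀)) ν₀ :=
    (hχ.differentiableAt.hasDerivAt.comp ν₀ haff).div_const (1 + z₀)
  unfold chiHatN
  refine hcomp.congr_deriv ?_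
  field_simp

/-- **`∂χ/∂ν(g,ν) = (1+z₀)² ∂χ̂/∂ν₀(m²,g₀,ν₀,z₀)`** (first equality of the last display of §4.1) (`g₀ ≥ 0`, `z₀ > -1`,
`ν > ν_c`). [cite: BauerschmidtBrydgesSlade2015LogCorr, §4.1 (display ∂χ/∂ν = (1+z₀)²∂χ̂/∂ν₀)] -/
theorem deriv_susceptibility_eq_mul_deriv_chiHat {g₀ : ℝ} (hg₀ : 0 ≤ g₀) (m2 ν₀ : ℝ) {z₀ : ℝ}
    (hz : -1 < z₀) (hν : criticalNu d (g₀ / (1 + z₀) ^ 2) < (ν₀ + m2) / (1 + z₀)) :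
    deriv (fun ν' => (susceptibility d (g₀ / (1 + z₀) ^ 2) ν').toReal) ((ν₀ + m2) / (1 + z₀))
      = (1 + z₀) ^ 2 * deriv (fun ν₀' => chiHat d m2 g₀ ν₀' z₀) ν₀ := by
  have h1 : (1 + z₀) ≠ 0 := by linarith
  rw [(hasDerivAt_chiHat hg₀ m2 ν₀ hz hν).deriv]
  field_simp

/-- **`∂χ̂/∂ν₀ = lim_{N→∞} ∂χ̂_N/∂ν₀`** above `ν_c` (second equality of the last display of §4.1) (along any periods
`n → ∞`; `g₀ ≥ 0`, `z₀ > -1`). [cite: BauerschmidtBrydgesSlade2015LogCorr, §4.1 (display ∂χ/∂ν = (1+z₀)² lim_N ∂χ̂_N/∂ν₀)] -/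
theorem tendsto_deriv_chiHatN {g₀ : ℝ} (hg₀ : 0 ≤ g₀) (m2 ν₀ : ℝ) {z₀ : ℝ} (hz : -1 < z₀)
    (hν : criticalNu d (g₀ / (1 + z₀) ^ 2) < (ν₀ + m2) / (1 + z₀)) :
    Tendsto (fun n => deriv (fun ν₀' => chiHatN d n m2 g₀ ν₀' z₀) ν₀) atTop
      (𝓝 (deriv (fun ν₀' => chiHat d m2 g₀ ν₀' z₀) ν₀)) := by
  simp_rw [fun n => (hasDerivAt_chiHatN n hg₀ m2 ν₀ hz hν).deriv,
    (hasDerivAt_chiHat hg₀ m2 ν₀ hz hν).deriv]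
  exact (tendsto_deriv_torusSusceptibility (bare_g_nonneg hg₀ z₀) hν).div_const _

/-- The same along `Λ_N`, `L ≥ 2`. [cite: BauerschmidtBrydgesSlade2015LogCorr, §4.1 (display ∂χ/∂ν = (1+z₀)² lim_N ∂χ̂_N/∂ν₀)] -/
theorem tendsto_deriv_chiHatN_pow {L : ℕ} (hL : 2 ≤ L) {g₀ : ℝ} (hg₀ : 0 ≤ g₀) (m2 ν₀ : ℝ)
    {z₀ : ℝ} (hz : -1 < z₀) (hν : criticalNu d (g₀ / (1 + z₀) ^ 2) < (ν₀ + m2) / (1 + z₀)) :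
    Tendsto (fun N : ℕ => deriv (fun ν₀' => chiHatN d (L ^ N) m2 g₀ ν₀' z₀) ν₀) atTop
      (𝓝 (deriv (fun ν₀' => chiHat d m2 g₀ ν₀' z₀) ν₀)) :=
  (tendsto_deriv_chiHatN hg₀ m2 ν₀ hz hν).comp (tendsto_pow_atTop_atTop_of_one_lt hL)

/-! ### The entry point of §8.4: identifying `χ̂` and `∂χ̂/∂ν₀` from the finite-volume flow -/

/-- **§8.4, first display from finite volume**: if the finite-volume renormalised susceptibilities
`χ̂_N(m²,g₀,ν₀,z₀)` (`N → ∞` along `Λ_N = ℤ^d/Lᴺℤ^d`, `L ≥ 2`, `d ≥ 1`, `g₀ > 0`, `z₀ > -1`)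
converge to a real number `A`, then the bare point `ν = (ν₀+m²)/(1+z₀)` lies above `ν_c(g)` and
`χ̂(m²,g₀,ν₀,z₀) = A` (Lemma 2.1: `χ_N ↑ χ` in `[0,∞]`, and `χ < ∞ ↔ ν > ν_c`, Lemma A.1). This is
how `χ̂ = 1/m²` is read off the finite-volume identity for `χ̂_N` in the source ("so that the limit is `m⁻²` as desired").
[cite: BauerschmidtBrydgesSlade2015LogCorr, §8.4 (proof of Theorem 4.1, first display) with §4.1 (display χ̂ = lim_{N→∞} χ̂_N) and Lemma 2.1] -/
theorem criticalNu_lt_and_chiHat_eq_of_tendsto (hd : 0 < d) {L : ℕ} (hL : 2 ≤ L) {g₀ : ℝ}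
    (hg₀ : 0 < g₀) (m2 ν₀ : ℝ) {z₀ : ℝ} (hz : -1 < z₀) {A : ℝ}
    (h : Tendsto (fun N : ℕ => chiHatN d (L ^ N) m2 g₀ ν₀ z₀) atTop (𝓝 A)) :
    criticalNu d (g₀ / (1 + z₀) ^ 2) < (ν₀ + m2) / (1 + z₀) ∧ chiHat d m2 g₀ ν₀ z₀ = A := by
  set g : ℝ := g₀ / (1 + z₀) ^ 2 with hg
  set ν : ℝ := (ν₀ + m2) / (1 + z₀) with hνdef
  have h1z : 0 < 1 + z₀ := by linarith
  have hgpos : 0 < g := div_pos hg₀ (pow_pos h1z 2)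
  have hL0 : L ≠ 0 := by omega
  -- `χ_N = ofReal ((1+z₀) χ̂_N)` (finite volume: `χ_N < ∞` as `g > 0`)
  have hfin : ∀ N : ℕ, torusSusceptibility d (L ^ N) g ν ≠ ∞ := fun N => by
    haveI : NeZero (L ^ N) := ⟨pow_ne_zero N hL0⟩
    exact (torusSusceptibility_lt_top (L ^ N) hgpos ν).ne
  have hrepr : ∀ N : ℕ, torusSusceptibility d (L ^ N) g ν =
      ENNReal.ofReal ((1 + z₀) * chiHatN d (L ^ N) m2 g₀ ν₀ z₀) := fun N => by
    rw [one_add_mul_chiHatN d (L ^ N) m2 g₀ ν₀ hz, ENNReal.ofReal_toReal (hfin N)]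
  -- the two limits of `χ_N`
  have hlim1 : Tendsto (fun N : ℕ => torusSusceptibility d (L ^ N) g ν) atTop
      (𝓝 (susceptibility d g ν)) := tendsto_torusSusceptibility_pow hL hgpos.le ν
  have hlim2 : Tendsto (fun N : ℕ => torusSusceptibility d (L ^ N) g ν) atTop
      (𝓝 (ENNReal.ofReal ((1 + z₀) * A))) := by
    simp_rw [hrepr]
    exact (ENNReal.continuous_ofReal.tendsto _).comp (h.const_mul (1 + z₀))
  have hχ : susceptibility d g ν = ENNReal.ofReal ((1 + z₀) * A) := tendsto_nhds_unique hlim1 hlim2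
  have hνc : criticalNu d g < ν :=
    (susceptibility_lt_top_iff hd hgpos.le ν).1 (by rw [hχ]; exact ENNReal.ofReal_lt_top)
  refine ⟨hνc, ?_⟩
  exact tendsto_nhds_unique (tendsto_chiHatN_pow hL hg₀.le m2 ν₀ z₀ hνc) h

/-- **§8.4, second display from finite volume**: above `ν_c`, if `∂χ̂_N/∂ν₀ → D` along `Λ_N`
then `∂χ̂/∂ν₀ = D` (Lemma 2.1, convergence of derivatives, through `∂χ/∂ν = (1+z₀)² lim_N ∂χ̂_N/∂ν₀`). This is how the
asymptotics of `χ̂'` is read off `-m⁻⁴ν_N'` and the `W`, `K` terms in the source.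
[cite: BauerschmidtBrydgesSlade2015LogCorr, §8.4 (proof of Theorem 4.1, second display) with §4.1 (display ∂χ/∂ν = (1+z₀)² lim_N ∂χ̂_N/∂ν₀) and Lemma 2.1] -/
theorem deriv_chiHat_eq_of_tendsto {L : ℕ} (hL : 2 ≤ L) {g₀ : ℝ} (hg₀ : 0 ≤ g₀) (m2 ν₀ : ℝ)
    {z₀ : ℝ} (hz : -1 < z₀) (hν : criticalNu d (g₀ / (1 + z₀) ^ 2) < (ν₀ + m2) / (1 + z₀))
    {D : ℝ} (h : Tendsto (fun N : ℕ => deriv (fun ν₀' => chiHatN d (L ^ N) m2 g₀ ν₀' z₀) ν₀)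
      atTop (𝓝 D)) :
    deriv (fun ν₀' => chiHat d m2 g₀ ν₀' z₀) ν₀ = D :=
  tendsto_nhds_unique (tendsto_deriv_chiHatN_pow hL hg₀ m2 ν₀ hz hν) h

end CTWSAW

end Literature.Barriers.CriticalPhenomena
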